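import Summits.Ventures.LatticeQCDFlow.Scaling.SwapLadderIndexTauIntClosedSimplex

/-!
HONEST FRAMING: exact (Metropolis-corrected) sampling algorithms for lattice gauge theory; figures
of merit are autocorrelation/cost numbers at stated couplings and volumes; no continuum-physics
claim.

# SwapLadderIndexTauIntCollapsePattern — THE SHAPE OF THE `τ_int`-OPTIMAL REPLICA SET AT ANY STIFFNESS: THE CLOSED-SIMPLEX
# MINIMISER IS UNIQUE, MIRROR-SYMMETRIC, ITS GAPS DO NOT INCREASE TOWARDS THE MIDDLE, AND ITS COLLAPSED (ZERO) GAPS FORM A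
# CENTRAL BLOCK (row 22 `su3-ptbc`, GEN-8, ours; sequel of `SwapLadderIndexTauIntClosedSimplex`)

Venture `LatticeQCDFlow` (cell pub-lqcd), topic `Scaling`; FANOUT row 22 (`su3-ptbc`).  NEW WORK of the cell over
`SwapLadderIndexTauIntClosedSimplex` (`closedGapSimplex`, `finIndexCost`, the one-sided Fermat condition
`weight_sq_mul_deriv_le_of_isMinOn_closed`: `v_i > 0 ⇒ w_i²·G′(v_i) ≤ w_j²·G′(v_j)` for every `j`), GEN-7's
`SwapLadderIndexTauIntOptimumShape` (`passageWeight_pos`, `passageWeight_symm`, `deriv_gaussInvAcc_pos`) and GEN-6's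
`strictMono_deriv_gaussInvAcc`.  Nothing is cited as a fact; no `native_decide`.

THE POINT (model statements).  `SwapLadderIndexTauIntOptimumShape` describes POSITIVE optima (above the threshold `Λ_c(K)` of
`SwapLadderIndexTauIntThreshold`); below the threshold the optimum on the closed simplex has zero gaps (replicas at the same
coupling).  The one-sided Fermat condition pins down its shape at EVERY total stiffness:
* **`passageWeight_lt_of_zero_gap`** — if gap `j` is collapsed (`v_j = 0`) and gap `i` is not, then `w_i < w_j`: collapsed gaps
  carry the LARGER passage weights; **`zero_of_zero_of_weight_le`** — hence `v_j = 0` and `w_j ≤ w_k` force `v_k = 0`;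
* **`zero_gap_central_block`** — with `w_k = (k+1)(K−k)` unimodal and mirror-symmetric (`passageWeight_le_of_between`:
  `j ≤ k`, `j + k ≤ K − 1` ⇒ `w_j ≤ w_k`), a collapsed gap `j` collapses every gap `k` between `j` and its mirror `K−1−j`: the
  collapsed gaps form a CENTRAL BLOCK, the positive gaps sit at the two ends;
* **`closedMinimiser_symm`** — every closed-simplex minimiser is mirror-symmetric, `v_{K−1−i} = v_i` (zero gaps by the block
  structure, positive ones by two-sided stationarity and injectivity of `G′`);
* **`closedMinimiser_antitone_to_middle`** — for `i ≤ k` with `i + k ≤ K − 1` (i.e. `k` between `i` and the middle):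
  `v_k ≤ v_i` — gaps do not increase towards the middle (strictly between positive gaps of different weight,
  `gap_lt_of_weight_lt_closed`).
So, in the model, "optimising the replica-index `τ_int` on a small stiffness budget" means: keep the end pairs, merge a
symmetric middle block of replicas.  And §4 **`closedMinimiser_unique`**: the closed-simplex minimiser is UNIQUE (strict convexity, midpoint argument), so this
is the shape of THE `τ_int`-optimal replica set.  NOT CLAIMED: the size of the collapsed block as a function of `Λ` (only
`Λ ≤ Λ_c(K) ⇔` the block is non-empty, `SwapLadderIndexTauIntThreshold`), anything about PTBC itself or a run.
-/

noncomputable section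

open Finset Real

namespace Summit.Ventures.LatticeQCDFlow.Scaling

/-! ## §1 Passage weights between an index and its mirror -/

section Weights

variable {K j k : ℕ}

/-- **`w_j ≤ w_k` whenever `k` lies between `j` and its mirror `K−1−j`** (`j ≤ k`, `j + k ≤ K − 1`):
`w_k − w_j = (k − j)(K − 1 − k − j) ≥ 0`. [ours] -/
theorem passageWeight_le_of_between (hjk : j ≤ k) (hsum : j + k + 1 ≤ K) : passageWeight K j ≤ passageWeight K k := by
  unfold passageWeight
  have h1 : (j : ℝ) ≤ k := by exact_mod_cast hjk
  have h2 : (j : ℝ) + k + 1 ≤ K := by exact_mod_cast hsum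
  nlinarith [mul_nonneg (sub_nonneg.2 h1) (show (0 : ℝ) ≤ (K : ℝ) - 1 - k - j by linarith)]

/-- The mirror version: `w_j ≤ w_k` for `k ≤ K − 1 − j` with `j ≤ k`… stated through the reflected index:
`w_{K−1−j} ≤ w_k` under the same betweenness (`w` is mirror-symmetric). [ours] -/
theorem passageWeight_mirror_le_of_between (hjk : j ≤ k) (hsum : j + k + 1 ≤ K) :
    passageWeight K (K - 1 - j) ≤ passageWeight K k := by
  rw [passageWeight_symm (show j < K by omega)]
  exact passageWeight_le_of_between hjk hsum

end Weights

/-! ## §2 Collapsed gaps carry the larger weights; the central block -/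

section Block

variable {K : ℕ} {Λ : ℝ} {v : Fin K → ℝ}

/-- **A collapsed gap outweighs every positive gap**: `v_j = 0`, `v_i > 0` ⇒ `w_i < w_j` (one-sided Fermat against `j`:
`w_i²·G′(v_i) ≤ w_j²·G′(0)` with `G′(v_i) > G′(0) > 0`). [ours] -/
theorem passageWeight_lt_of_zero_gap (hv : v ∈ closedGapSimplex K Λ)
    (hmin : IsMinOn (finIndexCost K) (closedGapSimplex K Λ) v) {i j : Fin K} (hi : 0 < v i) (hj : v j = 0) :
    passageWeight K i < passageWeight K j := by
  have h := weight_sq_mul_deriv_le_of_isMinOn_closed hv hmin hi j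
  rw [hj] at h
  have hG0 := deriv_gaussInvAcc_pos 0
  have hGi : deriv gaussInvAcc 0 < deriv gaussInvAcc (v i) := strictMono_deriv_gaussInvAcc hi
  have hwi := passageWeight_pos (K := K) i.isLt
  have hwj := passageWeight_pos (K := K) j.isLt
  by_contra hcon
  rw [not_lt] at hcon
  have h2 : passageWeight K j ^ 2 ≤ passageWeight K i ^ 2 := pow_le_pow_left₀ hwj.le hcon 2
  nlinarith [pow_pos hwi 2]

/-- **Hence a collapsed gap collapses every gap of larger-or-equal weight.** [ours] -/
theorem zero_of_zero_of_weight_le (hv : v ∈ closedGapSimplex K Λ)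
    (hmin : IsMinOn (finIndexCost K) (closedGapSimplex K Λ) v) {j k : Fin K} (hj : v j = 0)
    (hw : passageWeight K j ≤ passageWeight K k) : v k = 0 := by
  by_contra hk
  have hkpos : 0 < v k := lt_of_le_of_ne (hv.1 k) (Ne.symm hk)
  exact absurd (passageWeight_lt_of_zero_gap hv hmin hkpos hj) (not_lt.2 hw)

/-- **THE COLLAPSED GAPS FORM A CENTRAL BLOCK**: if gap `j` is collapsed then so is every gap `k` between `j` and its mirror
(`j ≤ k`, `j + k ≤ K − 1`). [ours] -/
theorem zero_gap_central_block (hv : v ∈ closedGapSimplex K Λ)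
    (hmin : IsMinOn (finIndexCost K) (closedGapSimplex K Λ) v) {j k : Fin K} (hj : v j = 0) (hjk : (j : ℕ) ≤ k)
    (hsum : (j : ℕ) + k + 1 ≤ K) : v k = 0 :=
  zero_of_zero_of_weight_le hv hmin hj (passageWeight_le_of_between hjk hsum)

/-- The mirror of a collapsed gap is collapsed. [ours] -/
theorem zero_gap_mirror (hv : v ∈ closedGapSimplex K Λ)
    (hmin : IsMinOn (finIndexCost K) (closedGapSimplex K Λ) v) {j : Fin K} (hj : v j = 0) :
    v ⟨K - 1 - j, by omega⟩ = 0 :=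
  zero_of_zero_of_weight_le hv hmin hj (by rw [passageWeight_symm j.isLt])

end Block

/-! ## §3 Mirror symmetry and the monotone shape of every closed-simplex minimiser -/

section Shape

variable {K : ℕ} {Λ : ℝ} {v : Fin K → ℝ}

/-- Two POSITIVE gaps of a closed-simplex minimiser are jointly stationary: `w_i²·G′(v_i) = w_k²·G′(v_k)`. [ours] -/
theorem stationary_of_pos (hv : v ∈ closedGapSimplex K Λ)
    (hmin : IsMinOn (finIndexCost K) (closedGapSimplex K Λ) v) {i k : Fin K} (hi : 0 < v i) (hk : 0 < v k) :
    passageWeight K i ^ 2 * deriv gaussInvAcc (v i) = passageWeight K k ^ 2 * deriv gaussInvAcc (v k) :=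
  le_antisymm (weight_sq_mul_deriv_le_of_isMinOn_closed hv hmin hi k)
    (weight_sq_mul_deriv_le_of_isMinOn_closed hv hmin hk i)

/-- Positive gaps of equal weight are equal. [ours] -/
theorem gap_eq_of_weight_eq_closed (hv : v ∈ closedGapSimplex K Λ)
    (hmin : IsMinOn (finIndexCost K) (closedGapSimplex K Λ) v) {i k : Fin K} (hi : 0 < v i) (hk : 0 < v k)
    (hw : passageWeight K i = passageWeight K k) : v i = v k := by
  have hs := stationary_of_pos hv hmin hi hk
  rw [hw] at hs
  have hwk := passageWeight_pos (K := K) k.isLt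
  exact strictMono_deriv_gaussInvAcc.injective (mul_left_cancel₀ (pow_pos hwk 2).ne' hs)

/-- **Smaller weight ⇒ larger gap among positive gaps**: `w_i < w_k`, `v_k > 0` ⇒ `v_k < v_i`. [ours] -/
theorem gap_lt_of_weight_lt_closed (hv : v ∈ closedGapSimplex K Λ)
    (hmin : IsMinOn (finIndexCost K) (closedGapSimplex K Λ) v) {i k : Fin K} (hk : 0 < v k)
    (hw : passageWeight K i < passageWeight K k) : v k < v i := by
  have hi : 0 < v i := by
    by_contra h
    have h0 : v i = 0 := le_antisymm (not_lt.1 h) (hv.1 i)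
    exact absurd (passageWeight_lt_of_zero_gap hv hmin hk h0) (not_lt.2 hw.le)
  have hs := stationary_of_pos hv hmin hi hk
  have hwi := passageWeight_pos (K := K) i.isLt
  by_contra hcon
  rw [not_lt] at hcon
  have hmono : deriv gaussInvAcc (v i) ≤ deriv gaussInvAcc (v k) := strictMono_deriv_gaussInvAcc.monotone hcon
  have hGi := deriv_gaussInvAcc_pos (v i)
  have hw2 : passageWeight K i ^ 2 < passageWeight K k ^ 2 := by nlinarith
  nlinarith [mul_le_mul_of_nonneg_left hmono (pow_pos hwi 2).le]

/-- **MIRROR SYMMETRY OF EVERY CLOSED-SIMPLEX MINIMISER: `v_{K−1−i} = v_i`.** [ours] -/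
theorem closedMinimiser_symm (hv : v ∈ closedGapSimplex K Λ)
    (hmin : IsMinOn (finIndexCost K) (closedGapSimplex K Λ) v) (i : Fin K) :
    v ⟨K - 1 - i, by omega⟩ = v i := by
  have hw : passageWeight K (⟨K - 1 - i, by omega⟩ : Fin K) = passageWeight K i := passageWeight_symm i.isLt
  rcases (hv.1 i).eq_or_lt with h0 | hpos
  · rw [← h0]
    exact zero_gap_mirror hv hmin h0.symm
  · have hpos' : 0 < v ⟨K - 1 - i, by omega⟩ := by
      by_contra h
      have h0 : v ⟨K - 1 - i, by omega⟩ = 0 := le_antisymm (not_lt.1 h) (hv.1 _)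
      have := passageWeight_lt_of_zero_gap hv hmin hpos h0
      rw [hw] at this
      exact lt_irrefl _ this
    exact gap_eq_of_weight_eq_closed hv hmin hpos' hpos hw

/-- **GAPS DO NOT INCREASE TOWARDS THE MIDDLE**: for `i ≤ k` with `i + k ≤ K − 1`, `v_k ≤ v_i`. [ours] -/
theorem closedMinimiser_antitone_to_middle (hv : v ∈ closedGapSimplex K Λ)
    (hmin : IsMinOn (finIndexCost K) (closedGapSimplex K Λ) v) {i k : Fin K} (hik : (i : ℕ) ≤ k)
    (hsum : (i : ℕ) + k + 1 ≤ K) : v k ≤ v i := by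
  have hw : passageWeight K i ≤ passageWeight K k := passageWeight_le_of_between hik hsum
  rcases (hv.1 k).eq_or_lt with h0 | hkpos
  · rw [← h0]; exact hv.1 i
  rcases hw.eq_or_lt with heq | hlt
  · have hi : 0 < v i := by
      by_contra h
      have h0 : v i = 0 := le_antisymm (not_lt.1 h) (hv.1 i)
      exact absurd (zero_of_zero_of_weight_le hv hmin h0 hw) hkpos.ne'
    exact (gap_eq_of_weight_eq_closed hv hmin hi hkpos heq).ge
  · exact (gap_lt_of_weight_lt_closed hv hmin hkpos hlt).le

end Shape

/-! ## §4 Uniqueness of the closed-simplex minimiser (strict convexity) -/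

section Unique

variable {K : ℕ} {Λ : ℝ} {v v' : Fin K → ℝ}

/-- The midpoint of two closed-simplex vectors is in the closed simplex. [ours] -/
theorem midpoint_mem_closedGapSimplex (hv : v ∈ closedGapSimplex K Λ) (hv' : v' ∈ closedGapSimplex K Λ) :
    (fun i => (v i + v' i) / 2) ∈ closedGapSimplex K Λ := by
  refine ⟨fun i => by have := hv.1 i; have := hv'.1 i; positivity, ?_⟩
  have h : ∑ i, (v i + v' i) / 2 = ((∑ i, v i) + ∑ i, v' i) / 2 := by
    rw [← sum_add_distrib, sum_div]
  rw [h, hv.2, hv'.2]; ring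

/-- **THE CLOSED-SIMPLEX MINIMISER IS UNIQUE** (the cost `Σ_j w_j²·G(v_j)` is strictly convex: `G` strictly convex,
`w_j > 0`; the midpoint of two distinct minimisers would cost strictly less).  So the symmetric, middle-collapsed shape of
§2–§3 describes THE `τ_int`-optimal replica set at every total stiffness. [ours] -/
theorem closedMinimiser_unique (hv : v ∈ closedGapSimplex K Λ) (hmin : IsMinOn (finIndexCost K) (closedGapSimplex K Λ) v)
    (hv' : v' ∈ closedGapSimplex K Λ) (hmin' : IsMinOn (finIndexCost K) (closedGapSimplex K Λ) v') : v = v' := by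
  by_contra hne
  obtain ⟨i, hi⟩ : ∃ i, v i ≠ v' i := by
    by_contra h
    simp only [not_exists, not_not] at h
    exact hne (funext h)
  set m : Fin K → ℝ := fun j => (v j + v' j) / 2 with hm
  have hmem := midpoint_mem_closedGapSimplex hv hv'
  -- termwise convexity, strict at `i`
  have hterm : ∀ j ∈ (univ : Finset (Fin K)),
      passageWeight K (j : ℕ) ^ 2 * gaussInvAcc (m j)
        ≤ (passageWeight K (j : ℕ) ^ 2 * gaussInvAcc (v j) + passageWeight K (j : ℕ) ^ 2 * gaussInvAcc (v' j)) / 2 := by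
    intro j _
    have hc := strictConvexOn_gaussInvAcc.convexOn.2 (Set.mem_univ (v j)) (Set.mem_univ (v' j))
      (show (0 : ℝ) ≤ 1 / 2 by norm_num) (show (0 : ℝ) ≤ 1 / 2 by norm_num) (by norm_num)
    simp only [smul_eq_mul] at hc
    have e : (1 / 2 : ℝ) * v j + 1 / 2 * v' j = m j := by rw [hm]; ring
    rw [e] at hc
    have hw : 0 ≤ passageWeight K (j : ℕ) ^ 2 := sq_nonneg _
    nlinarith [mul_le_mul_of_nonneg_left hc hw]
  have hstrict : passageWeight K (i : ℕ) ^ 2 * gaussInvAcc (m i)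
      < (passageWeight K (i : ℕ) ^ 2 * gaussInvAcc (v i) + passageWeight K (i : ℕ) ^ 2 * gaussInvAcc (v' i)) / 2 := by
    have hc := strictConvexOn_gaussInvAcc.2 (Set.mem_univ (v i)) (Set.mem_univ (v' i)) hi
      (show (0 : ℝ) < 1 / 2 by norm_num) (show (0 : ℝ) < 1 / 2 by norm_num) (by norm_num)
    simp only [smul_eq_mul] at hc
    have e : (1 / 2 : ℝ) * v i + 1 / 2 * v' i = m i := by rw [hm]; ring
    rw [e] at hc
    have hw : 0 < passageWeight K (i : ℕ) ^ 2 := pow_pos (passageWeight_pos i.isLt) 2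
    nlinarith [mul_lt_mul_of_pos_left hc hw]
  have hlt : finIndexCost K m < (finIndexCost K v + finIndexCost K v') / 2 := by
    unfold finIndexCost
    rw [← sum_add_distrib, sum_div]
    exact sum_lt_sum hterm ⟨i, mem_univ i, hstrict⟩
  have h1 : finIndexCost K v ≤ finIndexCost K m := isMinOn_iff.mp hmin m hmem
  have h2 : finIndexCost K v' ≤ finIndexCost K v := isMinOn_iff.mp hmin' v hv
  have h3 : finIndexCost K v ≤ finIndexCost K v' := isMinOn_iff.mp hmin v' hv'
  linarith

end Unique


end Summit.Ventures.LatticeQCDFlow.Scaling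

end
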